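import Literature.Computability.QuantumComplexity.CubicForrelation
import Literature.Computability.Complexity.CircuitComposition
import HarnessLib

/-!
# Signed cubic `k`-fold Forrelation (the SIGN of `Φ` as the promise)

Topic `Literature/Computability/QuantumComplexity` (item `defn-signedCubicForrelationProblem`,
route `QuantumAdvantage/CubicForrelation`, 2026-08-15 repair). Companion to `CubicForrelation.lean`
in the same vocabulary: the **signed** slices of explicit cubic `k₀`-fold Forrelation, whose
no-instances are the strongly ANTI-forrelated ones instead of the nearly un-forrelated ones:

* `signedCubicForrelationProblem k₀` — yes: `B₂`-circuits with `Φ ≥ 3/5` (literally the yes-side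
  of `cubicKForrelationProblem k₀`); no: `B₂`-circuits with `Φ ≤ -3/5`; throughout `k = k₀`
  circuits, `n` even, every circuit computing a function of algebraic degree `≤ 3`;
* `signedExactCubicForrelationProblem k₀` — yes: `Φ = 1` (the yes-side of
  `exactCubicForrelationProblem k₀`); no: `Φ = -1`.

Why these are natural: the one-control-qubit algorithm of Aaronson–Ambainis (2018), §3.2 Prop. 6
accepts with probability EXACTLY `(1 + Φ)/2`, which sees the sign of `Φ` (`≥ 4/5` on yes,
`≤ 1/5` on no, `1`/`0` on the exact slice), whereas squared statistics `Φ²` are blind to it; and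
complementing one function flips the sign, `Φ_{f₁,…,¬fⱼ,…,f_k} = -Φ_{f₁,…,f_k}` (each summand of
the twisted sum contains the factor `fⱼ(xⱼ)` exactly once). The cubic shape (`fᵢ = (-1)^{pᵢ}`,
`deg pᵢ ≤ 3`) is that of the hardness reduction, §6 Thm 25–26.

Contents: the two definitions; `rfl` agreement (`…_two_eq`) with the inline terms of the route
items `SignedCubicForrelation{NotPrBPP,InPrBPP,MemPromiseBQP}`, `SignedExactCubicForrelationNotPrBPP`
(`Summits/QuantumAdvantage/QuantumAdvantage/Theses/CubicForrelation.lean`, rev ≥ 3); codes iff's;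
yes-sides `=` the unsigned ones (`rfl`); signed-exact `⊆` signed on both sides; disjointness; the
glue "signed-exact `∉ PromiseBPP'` ⇒ signed `∉ PromiseBPP'`" (antitonicity in the promise); the
**negation gadget** `notCircuit C` (one NOT gate on the output wire: `eval` complemented, basis
`B₂` and algebraic degree preserved), `KForrelationInstance.negAt I j`, `kForrelationValue_not_at`
/ `value_negAt` (`Φ ↦ -Φ`); the **symmetry** yes ↔ no: `I.negAt j` is a no-instance iff `I` is a
yes-instance and vice versa (both problems), so codes of complemented yes-instances lie in the
no-side and conversely — equality "no-side = image of the yes-side" holds for the computed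
FUNCTION tuples (complementing is an involution there) but not for code sets (the `j`-th circuit
of a no-instance need not end in a NOT gate); non-vacuity of both sides at `k₀ = 2`, `n = 2`.

Not here: `PromiseBQP` / `PromiseBPP'` membership of the signed problems (route items; the
quantum upper bound is the Hadamard-test family of Prop. 6, not a sub-promise of Forrelation).

## References

* S. Aaronson, A. Ambainis, *Forrelation: a problem that optimally separates quantum from
  classical computing*, SIAM J. Comput. 47 (2018) 982–1038 (arXiv:1411.5729): §1.1.3, §3.2
  Prop. 6 (arXiv pp. 11–12: acceptance exactly `(1+Φ)/2`), §6 Thm 25–26 (p. 27).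
* O. Goldreich, *On promise problems* (2006), §1.1–1.2; H. Vollmer, *Introduction to Circuit
  Complexity* (1999), §1.2; C. Carlet, *Boolean Functions for Cryptography …* (2020), §2.2.1.
-/

noncomputable section

open Literature.Computability.Complexity Literature.Computability.Cryptography Finset

namespace Literature.Computability.QuantumComplexity

variable {n k d : ℕ}

/-! ### The signed slices -/

/-- **Signed cubic `k₀`-fold Forrelation**: codes of instances with `k₀` circuits, `n` even, all
functions of algebraic degree `≤ 3`; yes: `B₂`-circuits with `Φ ≥ 3/5` (`IsYes`, literally the
yes-side of `cubicKForrelationProblem k₀`); no: `B₂`-circuits with `Φ ≤ -3/5`. The algorithm of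
Prop. 6 accepts with probability exactly `(1+Φ)/2`, i.e. `≥ 4/5` resp. `≤ 1/5`.
[cite: AaronsonAmbainis2018, §3.2 Prop. 6 (pp. 11–12) and §6 Thm 25–26 (p. 27), with §1.1.3] -/
def signedCubicForrelationProblem (k₀ : ℕ) : PromiseProblem :=
  ⟨KForrelationInstance.encode ''
      {I | I.IsYes ∧ I.k = k₀ ∧ Even I.n ∧ ∀ i, IsDegLeFun 3 (I.C i).eval},
    KForrelationInstance.encode ''
      {I | (I.IsOverB2 ∧ I.value ≤ -(3 / 5 : ℝ)) ∧ I.k = k₀ ∧ Even I.n ∧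
        ∀ i, IsDegLeFun 3 (I.C i).eval}⟩

/-- **Signed exact cubic `k₀`-fold Forrelation**: as `signedCubicForrelationProblem k₀` but with
the exact conditions `Φ = 1` (yes; the yes-side of `exactCubicForrelationProblem k₀`) and
`Φ = -1` (no). For `k₀ = 2`: `g` bent with dual `f` (yes) resp. with dual `¬f` (no); the
algorithm of Prop. 6 decides it with certainty (acceptance `(1+Φ)/2 ∈ {0, 1}`).
[cite: AaronsonAmbainis2018, §3.2 Prop. 6 (pp. 11–12) and §6 Thm 25–26 (p. 27), with §1.1.3] -/
def signedExactCubicForrelationProblem (k₀ : ℕ) : PromiseProblem :=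
  ⟨KForrelationInstance.encode ''
      {I | I.IsOverB2 ∧ I.value = 1 ∧ I.k = k₀ ∧ Even I.n ∧ ∀ i, IsDegLeFun 3 (I.C i).eval},
    KForrelationInstance.encode ''
      {I | I.IsOverB2 ∧ I.value = -1 ∧ I.k = k₀ ∧ Even I.n ∧ ∀ i, IsDegLeFun 3 (I.C i).eval}⟩

/-! ### Agreement with the inline signatures of route `QuantumAdvantage/CubicForrelation` -/

/-- `signedCubicForrelationProblem 2` is, by `rfl`, the inline promise problem of the route items
`SignedCubicForrelationNotPrBPP`, `SignedCubicForrelationInPrBPP`,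
`SignedCubicForrelationMemPromiseBQP`. [cite: AaronsonAmbainis2018, §3.2 Prop. 6 and §6 Thm 25–26] -/
theorem signedCubicForrelationProblem_two_eq : signedCubicForrelationProblem 2 =
    (⟨KForrelationInstance.encode '' {I | I.IsYes ∧ I.k = 2 ∧ Even I.n ∧ ∀ i,
        IsDegLeFun 3 (I.C i).eval},
      KForrelationInstance.encode '' {I | (I.IsOverB2 ∧ I.value ≤ -(3 / 5 : ℝ)) ∧ I.k = 2 ∧
        Even I.n ∧ ∀ i, IsDegLeFun 3 (I.C i).eval}⟩ : PromiseProblem) :=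
  rfl

/-- `signedExactCubicForrelationProblem 2` is, by `rfl`, the inline promise problem of the route
item `SignedExactCubicForrelationNotPrBPP`. [cite: AaronsonAmbainis2018, §3.2 Prop. 6 and §6 Thm 25–26] -/
theorem signedExactCubicForrelationProblem_two_eq : signedExactCubicForrelationProblem 2 =
    (⟨KForrelationInstance.encode '' {I | I.IsOverB2 ∧ I.value = 1 ∧ I.k = 2 ∧ Even I.n ∧ ∀ i,
        IsDegLeFun 3 (I.C i).eval},
      KForrelationInstance.encode '' {I | I.IsOverB2 ∧ I.value = -1 ∧ I.k = 2 ∧ Even I.n ∧ ∀ i,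
        IsDegLeFun 3 (I.C i).eval}⟩ : PromiseProblem) :=
  rfl

/-! ### Codes, sub-promises, disjointness -/

/-- Membership of a code in the signed yes-side (`Φ ≥ 3/5`). [cite: AaronsonAmbainis2018, §6] -/
@[simp] theorem encode_mem_signedCubicForrelationProblem_yes_iff (k₀ : ℕ)
    (I : KForrelationInstance) : I.encode ∈ (signedCubicForrelationProblem k₀).yes ↔
      I.IsYes ∧ I.k = k₀ ∧ Even I.n ∧ ∀ i, IsDegLeFun 3 (I.C i).eval :=
  KForrelationInstance.encode_injective.mem_set_image

/-- Membership of a code in the signed no-side (`Φ ≤ -3/5`). [cite: AaronsonAmbainis2018, §6] -/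
@[simp] theorem encode_mem_signedCubicForrelationProblem_no_iff (k₀ : ℕ)
    (I : KForrelationInstance) : I.encode ∈ (signedCubicForrelationProblem k₀).no ↔
      (I.IsOverB2 ∧ I.value ≤ -(3 / 5 : ℝ)) ∧ I.k = k₀ ∧ Even I.n ∧
        ∀ i, IsDegLeFun 3 (I.C i).eval :=
  KForrelationInstance.encode_injective.mem_set_image

/-- Membership of a code in the signed exact yes-side (`Φ = 1`). [cite: AaronsonAmbainis2018, §6] -/
@[simp] theorem encode_mem_signedExactCubicForrelationProblem_yes_iff (k₀ : ℕ)
    (I : KForrelationInstance) : I.encode ∈ (signedExactCubicForrelationProblem k₀).yes ↔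
      I.IsOverB2 ∧ I.value = 1 ∧ I.k = k₀ ∧ Even I.n ∧ ∀ i, IsDegLeFun 3 (I.C i).eval :=
  KForrelationInstance.encode_injective.mem_set_image

/-- Membership of a code in the signed exact no-side (`Φ = -1`). [cite: AaronsonAmbainis2018, §6] -/
@[simp] theorem encode_mem_signedExactCubicForrelationProblem_no_iff (k₀ : ℕ)
    (I : KForrelationInstance) : I.encode ∈ (signedExactCubicForrelationProblem k₀).no ↔
      I.IsOverB2 ∧ I.value = -1 ∧ I.k = k₀ ∧ Even I.n ∧ ∀ i, IsDegLeFun 3 (I.C i).eval :=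
  KForrelationInstance.encode_injective.mem_set_image

/-- The signed problem has the yes-side of `CF_{k₀}`. [cite: AaronsonAmbainis2018, §1.1.3 and §6] -/
@[simp] theorem signedCubicForrelationProblem_yes (k₀ : ℕ) :
    (signedCubicForrelationProblem k₀).yes = (cubicKForrelationProblem k₀).yes := rfl

/-- The signed exact problem has the yes-side of the exact slice. [cite: AaronsonAmbainis2018, §6] -/
@[simp] theorem signedExactCubicForrelationProblem_yes (k₀ : ℕ) :
    (signedExactCubicForrelationProblem k₀).yes = (exactCubicForrelationProblem k₀).yes := rfl

/-- Signed-exact is a sub-promise of signed, yes-side: `Φ = 1 ⇒ Φ ≥ 3/5`. [cite: AaronsonAmbainis2018, §1.1.3] -/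
theorem signedExactCubicForrelationProblem_yes_subset (k₀ : ℕ) :
    (signedExactCubicForrelationProblem k₀).yes ≤ (signedCubicForrelationProblem k₀).yes :=
  exactCubicForrelationProblem_yes_subset k₀

/-- Signed-exact is a sub-promise of signed, no-side: `Φ = -1 ⇒ Φ ≤ -3/5`. [cite: AaronsonAmbainis2018, §1.1.3] -/
theorem signedExactCubicForrelationProblem_no_subset (k₀ : ℕ) :
    (signedExactCubicForrelationProblem k₀).no ≤ (signedCubicForrelationProblem k₀).no :=
  Set.image_mono fun _ hI => ⟨⟨hI.1, by rw [hI.2.1]; norm_num⟩, hI.2.2⟩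

/-- The signed problem is a genuine (disjoint) promise problem (`-3/5 < 3/5`). [cite: AaronsonAmbainis2018, §1.1.3] -/
theorem signedCubicForrelationProblem_disjoint (k₀ : ℕ) :
    (signedCubicForrelationProblem k₀).Disjoint := by
  refine Set.disjoint_left.2 ?_
  rintro w ⟨I, hI, rfl⟩ hno
  obtain ⟨⟨-, hv⟩, -⟩ := (encode_mem_signedCubicForrelationProblem_no_iff k₀ I).1 hno
  linarith [hI.1.2]

/-- The signed exact problem is a genuine (disjoint) promise problem (`-1 ≠ 1`). [cite: AaronsonAmbainis2018, §1.1.3] -/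
theorem signedExactCubicForrelationProblem_disjoint (k₀ : ℕ) :
    (signedExactCubicForrelationProblem k₀).Disjoint :=
  Disjoint.mono (signedExactCubicForrelationProblem_yes_subset k₀)
    (signedExactCubicForrelationProblem_no_subset k₀) (signedCubicForrelationProblem_disjoint k₀)

/-- **Hardness transfers up the promise**: `PromiseBPP'` is antitone in the promise, so if the
signed EXACT slice is not in `PromiseBPP'` then neither is the signed problem (the route's glue
`SignedExactHardImpliesTarget` at `k₀ = 2`). [cite: Goldreich2006, §1.1–1.2 (restricting the promise)] -/
theorem signedCubicForrelationProblem_not_mem_PromiseBPP'_of_exact (k₀ : ℕ)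
    (h : signedExactCubicForrelationProblem k₀ ∉ PromiseBPP') :
    signedCubicForrelationProblem k₀ ∉ PromiseBPP' := by
  rintro ⟨L', hL', p, hyes, hno⟩
  exact h ⟨L', hL', p, fun x hx => hyes x (signedExactCubicForrelationProblem_yes_subset k₀ hx),
    fun x hx => hno x (signedExactCubicForrelationProblem_no_subset k₀ hx)⟩

/-! ### Negating the output of a circuit -/

/-- The circuit `C` followed by one NOT gate reading its output wire (composition of circuits;
size `+ 1`). [cite: Vollmer1999, §1.2] -/
def notCircuit {ι : Type*} (C : Circuit ι) : Circuit ι where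
  gates := C.gates ++ [⟨1, fun v => !v 0, fun _ => C.output⟩]
  output := .inr C.gates.length
  wf j hj a m ha :=
    ((GateList.wf_gates C).append_singleton (fun _ m' hm' => C.wf_output m' hm')) j _
      (List.getElem?_eq_getElem hj) a m ha
  wf_output m hm := by
    simp only [Sum.inr.injEq] at hm
    subst hm
    simp

/-- `notCircuit C` computes the complement of what `C` computes. [cite: Vollmer1999, §1.2] -/
@[simp] theorem notCircuit_eval {ι : Type*} (C : Circuit ι) (x : ι → Bool) :
    (notCircuit C).eval x = !C.eval x := by
  have hC : C.eval x = GateList.wireOf x (GateList.vals C.gates x) C.output := by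
    obtain ⟨gs, o, hwf, ho⟩ := C
    cases o <;> rfl
  show (GateList.vals (C.gates ++ [_]) x).getD C.gates.length false = _
  rw [GateList.vals_append_singleton, List.getD_eq_getElem?_getD,
    List.getElem?_append_right (by simp), GateList.length_vals, Nat.sub_self, hC]
  simp

/-- `notCircuit C` has `GateFn.not` as its only new gate: over a basis containing NOT it is over
the basis iff `C` is. [cite: Vollmer1999, §1.2] -/
theorem notCircuit_isOver_iff {ι : Type*} {B : Set GateFn} (hB : GateFn.not ∈ B) (C : Circuit ι) :
    (notCircuit C).IsOver B ↔ C.IsOver B := by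
  refine ⟨fun h g hg => h g (List.mem_append_left _ hg), fun h g hg => ?_⟩
  simp only [notCircuit, List.mem_append, List.mem_singleton] at hg
  rcases hg with hg | rfl
  · exact h g hg
  · exact hB

/-- In particular `notCircuit C` is a `B₂`-circuit iff `C` is. [cite: Vollmer1999, §1.2] -/
@[simp] theorem notCircuit_isOver_B2_iff {ι : Type*} (C : Circuit ι) :
    (notCircuit C).IsOver B2 ↔ C.IsOver B2 :=
  notCircuit_isOver_iff not_mem_B2 C

/-- Complementing a Boolean function keeps its algebraic degree (`p ↦ p + 1`). [cite: Carlet2020, §2.2.1 Def. 6] -/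
theorem IsDegLeFun.not {f : (Fin n → Bool) → Bool} (h : IsDegLeFun d f) :
    IsDegLeFun d fun x => !f x := by
  obtain ⟨p, hp, hf⟩ := h
  refine ⟨p + 1, (MvPolynomial.totalDegree_add _ _).trans (max_le hp ?_), fun x => ?_⟩
  · rw [MvPolynomial.totalDegree_one]
    exact Nat.zero_le _
  · show (!f x) = _
    rw [hf x]
    simp only [polyPhase, map_add, map_one]
    generalize MvPolynomial.eval _ p = a
    fin_cases a <;> decide

/-- … so `f` and `¬f` have the same degree bounds. [cite: Carlet2020, §2.2.1 Def. 6] -/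
@[simp] theorem isDegLeFun_not_iff {f : (Fin n → Bool) → Bool} :
    IsDegLeFun d (fun x => !f x) ↔ IsDegLeFun d f :=
  ⟨fun h => by simpa using h.not, IsDegLeFun.not⟩

/-- **Complementing one function flips the `k`-fold forrelation**:
`Φ_{f₀,…,¬fⱼ,…,f_{k-1}} = -Φ_{f₀,…,f_{k-1}}` (every summand of the twisted sum contains the factor
`fⱼ(xⱼ)` exactly once). [cite: AaronsonAmbainis2018, §1.1.3] -/
theorem kForrelationValue_not_at {j : ℕ} (hj : j < k) (f : Fin k → (Fin n → Bool) → Bool) :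
    kForrelationValue (fun i y => if (i : ℕ) = j then !f i y else f i y) =
      -kForrelationValue f := by
  unfold kForrelationValue
  rw [← mul_neg, ← Finset.sum_neg_distrib]
  congr 1
  refine Finset.sum_congr rfl fun x _ => ?_
  have hs : ∀ i : Fin k, signOf (if (i : ℕ) = j then !f i (x i) else f i (x i)) =
      (if i = ⟨j, hj⟩ then -1 else 1) * signOf (f i (x i)) := by
    intro i
    by_cases h : (i : ℕ) = j
    · rw [if_pos h, if_pos (Fin.ext h)]
      cases f i (x i) <;> simp [signOf]
    · rw [if_neg h, if_neg (fun h' => h (by rw [h'])), one_mul]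
  simp_rw [hs, mul_assoc]
  rw [Finset.prod_mul_distrib, Finset.prod_ite_eq']
  simp

namespace KForrelationInstance

/-- Complement the output of the `j`-th circuit of an instance (no-op for `j ≥ k`). [cite: AaronsonAmbainis2018, §6] -/
def negAt (I : KForrelationInstance) (j : ℕ) : KForrelationInstance :=
  ⟨I.n, I.k, fun i => if (i : ℕ) = j then notCircuit (I.C i) else I.C i⟩

/-- Same arity. [cite: AaronsonAmbainis2018, §6] -/
@[simp] theorem negAt_n (I : KForrelationInstance) (j : ℕ) : (I.negAt j).n = I.n := rfl

/-- Same number of circuits. [cite: AaronsonAmbainis2018, §6] -/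
@[simp] theorem negAt_k (I : KForrelationInstance) (j : ℕ) : (I.negAt j).k = I.k := rfl

/-- The functions computed by `I.negAt j`: the `j`-th one is complemented. [cite: AaronsonAmbainis2018, §6] -/
theorem negAt_eval (I : KForrelationInstance) (j : ℕ) (i : Fin I.k) (y : Fin I.n → Bool) :
    ((I.negAt j).C i).eval y = if (i : ℕ) = j then !(I.C i).eval y else (I.C i).eval y := by
  show (if (i : ℕ) = j then notCircuit (I.C i) else I.C i).eval y = _
  split_ifs <;> simp

/-- **`Φ(I.negAt j) = -Φ(I)`** for `j < k`. [cite: AaronsonAmbainis2018, §1.1.3 and §6] -/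
theorem value_negAt (I : KForrelationInstance) {j : ℕ} (hj : j < I.k) :
    (I.negAt j).value = -I.value := by
  have h : (fun i => ((I.negAt j).C i).eval) =
      fun (i : Fin I.k) (y : Fin I.n → Bool) => if (i : ℕ) = j then !(I.C i).eval y
        else (I.C i).eval y :=
    funext fun i => funext fun y => negAt_eval I j i y
  unfold value
  rw [h]
  exact kForrelationValue_not_at hj _

/-- Complementing an output preserves (and reflects) being over `B₂`. [cite: Vollmer1999, §1.2] -/
@[simp] theorem isOverB2_negAt_iff (I : KForrelationInstance) (j : ℕ) :
    (I.negAt j).IsOverB2 ↔ I.IsOverB2 := by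
  refine forall_congr' fun i => ?_
  show (if (i : ℕ) = j then notCircuit (I.C i) else I.C i).IsOver B2 ↔ _
  split_ifs
  · exact notCircuit_isOver_B2_iff _
  · exact Iff.rfl

/-- Complementing an output preserves (and reflects) the degree bounds. [cite: Carlet2020, §2.2.1 Def. 6] -/
@[simp] theorem isDegLeFun_negAt_iff (I : KForrelationInstance) (j d : ℕ) :
    (∀ i : Fin I.k, IsDegLeFun d ((I.negAt j).C i).eval) ↔ ∀ i, IsDegLeFun d (I.C i).eval := by
  refine forall_congr' fun i => ?_
  have h : ((I.negAt j).C i).eval =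
      fun (y : Fin I.n → Bool) => if (i : ℕ) = j then !(I.C i).eval y else (I.C i).eval y :=
    funext fun y => negAt_eval I j i y
  rw [h]
  split_ifs
  · exact isDegLeFun_not_iff
  · exact Iff.rfl

/-- Transfer of all side conditions of the signed problems along `I ↦ I.negAt j` (`j < k₀`),
the value condition `P` becoming `Q` with `P (-v) ↔ Q v`. [cite: AaronsonAmbainis2018, §1.1.3 and §6] -/
theorem negAt_conditions_iff (I : KForrelationInstance) {j k₀ : ℕ} (hj : j < k₀) (P Q : ℝ → Prop)
    (hPQ : ∀ v, P (-v) ↔ Q v) :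
    ((I.negAt j).IsOverB2 ∧ P (I.negAt j).value ∧ (I.negAt j).k = k₀ ∧ Even (I.negAt j).n ∧
        ∀ i : Fin I.k, IsDegLeFun 3 ((I.negAt j).C i).eval) ↔
      (I.IsOverB2 ∧ Q I.value ∧ I.k = k₀ ∧ Even I.n ∧ ∀ i, IsDegLeFun 3 (I.C i).eval) := by
  rw [isOverB2_negAt_iff, isDegLeFun_negAt_iff, negAt_k, negAt_n]
  constructor
  · rintro ⟨hB, hv, hk, hn, hdeg⟩
    rw [value_negAt I (hk ▸ hj)] at hv
    exact ⟨hB, (hPQ _).1 hv, hk, hn, hdeg⟩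
  · rintro ⟨hB, hv, hk, hn, hdeg⟩
    refine ⟨hB, ?_, hk, hn, hdeg⟩
    rw [value_negAt I (hk ▸ hj)]
    exact (hPQ _).2 hv

end KForrelationInstance

/-! ### Symmetry: complementing one circuit swaps the two sides -/

/-- **`I.negAt j` is a signed no-instance iff `I` is a signed yes-instance** (`j < k₀`):
`Φ ↦ -Φ`; basis, `k`, `n` and degrees unchanged. [cite: AaronsonAmbainis2018, §1.1.3 and §3.2 Prop. 6] -/
theorem negAt_encode_mem_signedCubicForrelationProblem_no_iff {k₀ j : ℕ} (hj : j < k₀)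
    (I : KForrelationInstance) :
    (I.negAt j).encode ∈ (signedCubicForrelationProblem k₀).no ↔
      I.encode ∈ (signedCubicForrelationProblem k₀).yes := by
  simp only [encode_mem_signedCubicForrelationProblem_no_iff,
    encode_mem_signedCubicForrelationProblem_yes_iff, KForrelationInstance.IsYes, and_assoc]
  exact I.negAt_conditions_iff hj (· ≤ -(3 / 5 : ℝ)) ((3 : ℝ) / 5 ≤ ·) fun v => by
    constructor <;> intro h <;> linarith

/-- **`I.negAt j` is a signed yes-instance iff `I` is a signed no-instance** (`j < k₀`).
[cite: AaronsonAmbainis2018, §1.1.3 and §3.2 Prop. 6] -/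
theorem negAt_encode_mem_signedCubicForrelationProblem_yes_iff {k₀ j : ℕ} (hj : j < k₀)
    (I : KForrelationInstance) :
    (I.negAt j).encode ∈ (signedCubicForrelationProblem k₀).yes ↔
      I.encode ∈ (signedCubicForrelationProblem k₀).no := by
  simp only [encode_mem_signedCubicForrelationProblem_no_iff,
    encode_mem_signedCubicForrelationProblem_yes_iff, KForrelationInstance.IsYes, and_assoc]
  exact I.negAt_conditions_iff hj ((3 : ℝ) / 5 ≤ ·) (· ≤ -(3 / 5 : ℝ)) fun v => by
    constructor <;> intro h <;> linarith

/-- Exact version: `I.negAt j` has `Φ = -1` iff `I` has `Φ = 1` (`j < k₀`), other conditions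
unchanged. [cite: AaronsonAmbainis2018, §1.1.3 and §3.2 Prop. 6] -/
theorem negAt_encode_mem_signedExactCubicForrelationProblem_no_iff {k₀ j : ℕ} (hj : j < k₀)
    (I : KForrelationInstance) :
    (I.negAt j).encode ∈ (signedExactCubicForrelationProblem k₀).no ↔
      I.encode ∈ (signedExactCubicForrelationProblem k₀).yes := by
  simp only [encode_mem_signedExactCubicForrelationProblem_no_iff,
    encode_mem_signedExactCubicForrelationProblem_yes_iff]
  exact I.negAt_conditions_iff hj (· = -1) (· = 1) fun v => neg_inj

/-- Exact version: `I.negAt j` has `Φ = 1` iff `I` has `Φ = -1` (`j < k₀`).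
[cite: AaronsonAmbainis2018, §1.1.3 and §3.2 Prop. 6] -/
theorem negAt_encode_mem_signedExactCubicForrelationProblem_yes_iff {k₀ j : ℕ} (hj : j < k₀)
    (I : KForrelationInstance) :
    (I.negAt j).encode ∈ (signedExactCubicForrelationProblem k₀).yes ↔
      I.encode ∈ (signedExactCubicForrelationProblem k₀).no := by
  simp only [encode_mem_signedExactCubicForrelationProblem_no_iff,
    encode_mem_signedExactCubicForrelationProblem_yes_iff]
  exact I.negAt_conditions_iff hj (· = 1) (· = -1) fun v => neg_eq_iff_eq_neg

/-- Hence the codes of the complemented signed yes-instances lie in the signed no-side (and, by the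
previous lemma, conversely); as explained in the module docstring this inclusion of CODE sets is
proper in general. [cite: AaronsonAmbainis2018, §1.1.3 and §3.2 Prop. 6] -/
theorem image_negAt_yes_subset_signedCubicForrelationProblem_no {k₀ j : ℕ} (hj : j < k₀) :
    (fun I : KForrelationInstance => (I.negAt j).encode) ''
        {I | I.IsYes ∧ I.k = k₀ ∧ Even I.n ∧ ∀ i, IsDegLeFun 3 (I.C i).eval} ⊆
      (signedCubicForrelationProblem k₀).no := by
  rintro _ ⟨I, hI, rfl⟩
  exact (negAt_encode_mem_signedCubicForrelationProblem_no_iff hj I).2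
    ((encode_mem_signedCubicForrelationProblem_yes_iff k₀ I).2 hI)

/-! ### Non-vacuity at `k₀ = 2`, `n = 2` -/

/-- `andPairInstance` (`f = g = x₀ ∧ x₁`, `Φ = 1`) is a yes-instance of the signed exact problem.
[cite: AaronsonAmbainis2018, §1.1.3 and §6] -/
theorem encode_andPairInstance_mem_signedExactCubicForrelationProblem_yes :
    andPairInstance.encode ∈ (signedExactCubicForrelationProblem 2).yes :=
  encode_andPairInstance_mem_exactCubicForrelationProblem_yes

/-- Its partner with the second circuit complemented (`f = x₀ ∧ x₁`, `g = ¬(x₀ ∧ x₁)`) has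
`Φ = -1`. [cite: AaronsonAmbainis2018, §1.1.1] -/
theorem andPairInstance_negAt_one_value : (andPairInstance.negAt 1).value = -1 := by
  rw [KForrelationInstance.value_negAt _ (show 1 < 2 by norm_num), andPairInstance_value]

/-- … so it is a no-instance of the signed exact problem: both sides (and, by the sub-promise
lemmas, both sides of `signedCubicForrelationProblem 2`) are non-empty. [cite: AaronsonAmbainis2018, §1.1.3 and §6] -/
theorem encode_andPairInstance_negAt_mem_signedExactCubicForrelationProblem_no :
    (andPairInstance.negAt 1).encode ∈ (signedExactCubicForrelationProblem 2).no :=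
  (negAt_encode_mem_signedExactCubicForrelationProblem_no_iff (by norm_num) _).2
    encode_andPairInstance_mem_signedExactCubicForrelationProblem_yes

end Literature.Computability.QuantumComplexity

end
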